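import Literature.Probability.LatticeModels.DartPhase
import Literature.Probability.LatticeModels.DirichletGreenFunction
import Literature.Probability.RandomPlanarGeometry.PlanarDomains
import Summits.CriticalPhenomena.CardyFormulaZ2.Theorems.CardySusyWardParafermionPrecompactKenyonDefs
import Summits.CriticalPhenomena.CardyFormulaZ2.Theorems.CardySusyWardParafermionPrecompactCodedCycleOrientation

/-!
# Winding numbers of fine faces along a cycle of the turning rule, II: transport lemmas
# (helper for stub `stub_vertexRelation`)

Line `kenyon-stream-second-relation` of the crux `ParafermionPrecompact` (route `CardySusyWard`,
item stmt-CriticalPhenomena-11293); continuation of `…CodedCycleOrientation.lean` (the coded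
closed walk `c` of a cycle of `nextCorner β`, `c.v m = code (orb m)`; fine face `2v - (1,1)` of a
vertex, `2f` of a face). Proved here:

* `coded_W_fFace` / `coded_W_vFace`: along the cycle, the fine face of the FACE of every corner
  has the right winding number `R = W (rf v₀ v₁)` of the coded walk, the fine face of its VERTEX
  has `R + 1` (the two untaken forward fine edges at a code carry no traversal,
  `coded_W_sides_eq`, by `code_ne_code_nextCorner_add_dir`);
* `coded_W_vFace_of_mem` (registered helper): an OPEN lattice edge does not separate the fine
  faces of its endpoints — no cycle of the turning rule crosses an open edge, so the two fine
  edges between them carry no traversal;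
* `coded_W_vFace_eq_fFace_of_notMem`: a corner OFF the cycle does not separate the fine face of
  its vertex from that of its face (its code is an unvisited fine vertex).

These are the combinatorial transports of the orientation argument for the loops excised by the
one-edge involution (DCS 2012, Prop. 8.6 at `q = 1`): the winding number is carried from the
toggled edge back along the exploration to the outer face of `e_a`, where a Jordan-domain
argument makes it vanish. References: S. Smirnov, Ann. of Math. 172 (2010), §4 [Smirnov2010];
H. Duminil-Copin, S. Smirnov, Clay Math. Proc. 15 (2012), §8.3 [DuminilCopinSmirnov2012Lattice].
-/

noncomputable section

namespace Summit.CriticalPhenomena.CardyFormulaZ2.Cruxes.ParafermionPrecompact.KenyonStreamSecondRelation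

open Finset
open _root_.Literature.Topology.PlaneTopology _root_.Literature.Topology.PlaneTopology.RectLoop
open _root_.Literature.Probability.LatticeModels
open _root_.Literature.Probability.Percolation (BondConfig)

section CodedCycle

open _root_.Literature.Topology.PlaneTopology.RectLoop (code codeOff dir cross)

variable {β : BondConfig (Site 2)} {q : Site 2 × Fin 4} {Q : ℕ}

/-- Forward traversal counts of the coded walk: the edge out of the `m`-th code towards `P` is
traversed iff `P` is the next code. [folklore] -/
theorem coded_cnt_fwd (c : ClosedWalk Q) (hc : ∀ m, c.v m = code (cornerOrbit β q m)) (hs : c.Simple) (hQ0 : 0 < Q) (m : ℕ) (P : ℤ × ℤ) :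
    c.cnt (c.v m) P = indZ (code (cornerOrbit β q (m + 1)) = P) := by
  rw [c.cnt_out hs hQ0, hc]

/-- Backward traversal counts: the edge into the `m`-th code from `P` is traversed iff `P` is
the code of the predecessor `orb (m + Q - 1)`. [folklore] -/
theorem coded_cnt_bwd (c : ClosedWalk Q) (hc : ∀ m, c.v m = code (cornerOrbit β q m)) (hs : c.Simple) (hQ0 : 0 < Q) (m : ℕ) (P : ℤ × ℤ) :
    c.cnt P (c.v m) = indZ (code (cornerOrbit β q (m + (Q - 1))) = P) := by
  have h : c.v m = c.v (m + (Q - 1) + 1) := by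
    rw [show m + (Q - 1) + 1 = m + Q by omega, c.periodic]
  rw [h, c.cnt_in hs hQ0, hc]

/-- The predecessor steps into the corner: `next (orb (m + Q - 1)) = orb m`. [folklore] -/
theorem nextCorner_pred (hQ0 : 0 < Q) (hQ : cornerOrbit β q Q = q) (m : ℕ) :
    nextCorner β (cornerOrbit β q (m + (Q - 1))) = cornerOrbit β q m := by
  change cornerOrbit β q (m + (Q - 1) + 1) = _
  rw [show m + (Q - 1) + 1 = m + Q by omega, cornerOrbit_add_period hQ]

/-- **The two forward fine edges at a code that are not the step taken carry no traversal.**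
For `j ∈ {k+1, k+2}` (`k` the face index of `orb m`), if the step out of the `m`-th code is not
`dir j`, the faces on the two sides of `[code, code + dir j]` have equal winding numbers.
[folklore] -/
theorem coded_W_sides_eq (c : ClosedWalk Q) (hc : ∀ m, c.v m = code (cornerOrbit β q m)) (hs : c.Simple) (hQ0 : 0 < Q) (hQ : cornerOrbit β q Q = q) (m : ℕ) {j : Fin 4}
    (hj : j = (cornerOrbit β q m).2 + 1 ∨ j = (cornerOrbit β q m).2 + 2)
    (hne : c.v (m + 1) ≠ c.v m + dir j) :
    c.W (ClosedWalk.rf (c.v m) (c.v m + dir j)) = c.W (ClosedWalk.rf (c.v m + dir j) (c.v m)) := by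
  apply W_sides_eq_of_cnt
  · rw [coded_cnt_fwd c hc hs hQ0, indZ_of_neg]
    rw [← hc]; exact hne
  · rw [coded_cnt_bwd c hc hs hQ0, indZ_of_neg]
    intro h
    have hpred := nextCorner_pred (β := β) hQ0 hQ m
    have := code_ne_code_nextCorner_add_dir (β := β) (cornerOrbit β q (m + (Q - 1))) (j := j)
      (by rw [hpred]; exact hj)
    rw [hpred, ← hc m] at this
    exact this h

/-- **Right faces of the cycle.** The fine face `2 f` of the face `f` of every corner of the cycle
has the right winding number `R` of the coded walk. [folklore] -/
theorem coded_W_fFace (c : ClosedWalk Q) (hc : ∀ m, c.v m = code (cornerOrbit β q m)) (hQ0 : 0 < Q) (hQ : cornerOrbit β q Q = q)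
    (hmin : ∀ s, 0 < s → s < Q → cornerOrbit β q s ≠ q) (m : ℕ) :
    c.W (2 * cFace (cornerOrbit β q m) 0, 2 * cFace (cornerOrbit β q m) 1) =
      c.W (ClosedWalk.rf (c.v 0) (c.v 1)) := by
  have hs := coded_simple c hc hQ0 hQ hmin
  have h3 := three_le_period (β := β) hQ0 hQ
  rw [← c.W_rf_eq hs h3 m, ← rf_code_follow, ← hc]
  set p := cornerOrbit β q m with hp
  have hv1 : c.v (m + 1) = code (nextCorner β p) := by rw [hc]; rfl
  by_cases h : cTgt p ∈ β
  · -- follow: the step out is `dir (k+1)` itself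
    rw [hv1, code_nextCorner_of_mem h, ← hc]
  · -- cross: the step out is `dir (k+2)`; the edge `dir (k+1)` is untraversed
    rw [coded_W_sides_eq c hc hs hQ0 hQ m (Or.inl rfl), rf_rev_eq, hv1, code_nextCorner_of_not_mem h, ← hc]
    rw [hv1, code_nextCorner_of_not_mem h, ← hc, Ne, add_right_inj]
    generalize p.2 = k
    fin_cases k <;> simp [dir]

/-- **Left vertices of the cycle.** The fine face `2v - (1,1)` of the vertex `v` of every corner of
the cycle has winding number `R + 1`. [folklore] -/
theorem coded_W_vFace (c : ClosedWalk Q) (hc : ∀ m, c.v m = code (cornerOrbit β q m)) (hQ0 : 0 < Q) (hQ : cornerOrbit β q Q = q)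
    (hmin : ∀ s, 0 < s → s < Q → cornerOrbit β q s ≠ q) (m : ℕ) :
    c.W (2 * (cornerOrbit β q m).1 0 - 1, 2 * (cornerOrbit β q m).1 1 - 1) =
      c.W (ClosedWalk.rf (c.v 0) (c.v 1)) + 1 := by
  have hs := coded_simple c hc hQ0 hQ hmin
  have h3 := three_le_period (β := β) hQ0 hQ
  rw [← c.W_rf_eq hs h3 m, ← closedWalk_W_lf c hs h3 m, ← rf_code_cross_rev, ← hc]
  set p := cornerOrbit β q m with hp
  have hv1 : c.v (m + 1) = code (nextCorner β p) := by rw [hc]; rfl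
  by_cases h : cTgt p ∈ β
  · -- follow: step `dir (k+1)`; the edge `dir (k+2)` is untraversed
    rw [← coded_W_sides_eq c hc hs hQ0 hQ m (Or.inr rfl), ← rf_rev_eq, hv1, code_nextCorner_of_mem h, ← hc]
    rw [hv1, code_nextCorner_of_mem h, ← hc, Ne, add_right_inj]
    generalize p.2 = k
    fin_cases k <;> simp [dir]
  · -- cross: the step out is `dir (k+2)` itself
    rw [hv1, code_nextCorner_of_not_mem h, ← hc]

/-- Traversed fine edges join the codes of a corner and of its successor. [folklore] -/
theorem nextCorner_eq_of_cnt_ne_zero (c : ClosedWalk Q) (hc : ∀ m, c.v m = code (cornerOrbit β q m)) {a b : Site 2 × Fin 4} (h : c.cnt (code a) (code b) ≠ 0) :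
    nextCorner β a = b := by
  obtain ⟨j, -, hj⟩ := Finset.exists_ne_zero_of_sum_ne_zero h
  rw [indZ_apply] at hj
  split_ifs at hj with hab
  · rw [hc, hc] at hab
    obtain ⟨ha, hb⟩ := hab
    have ha' := code_injective ha
    apply code_injective
    rw [← hb, ← ha']
    rfl
  · exact absurd rfl hj

/-- **Open edges do not separate left vertices**: if the lattice edge `{u, u + u_k}` is open, the
fine faces of its two endpoints have the same winding number (no cycle of the turning rule
crosses an open edge). [folklore] -/
theorem coded_W_vFace_of_mem :
    ∀ (β : BondConfig (Site 2)) (q : Site 2 × Fin 4) (Q : ℕ) (c : ClosedWalk Q),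
      (∀ m, c.v m = RectLoop.code (cornerOrbit β q m)) → ∀ (u : Site 2) (k : Fin 4),
        s(u, u + cornerUnit k) ∈ β →
          c.W (2 * u 0 - 1, 2 * u 1 - 1) = c.W (2 * (u + cornerUnit k) 0 - 1, 2 * (u + cornerUnit k) 1 - 1) := by
  intro β q Q c hc u k h
  -- the four "crossing" transitions at the two endpoints never happen
  have hA : ∀ (w : Site 2) (j : Fin 4), s(w, w + cornerUnit j) ∈ β →
      c.cnt (code (w, j + 3)) (code (w, j)) = 0 ∧ c.cnt (code (w, j)) (code (w, j + 3)) = 0 ∧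
      c.cnt (code (w + cornerUnit j, j + 1)) (code (w + cornerUnit j, j + 2)) = 0 ∧
      c.cnt (code (w + cornerUnit j, j + 2)) (code (w + cornerUnit j, j + 1)) = 0 := by
    intro w j hw
    have t1 : cTgt (w, j + 3) = s(w, w + cornerUnit j) := by
      rw [cTgt]; simp only; rw [fin4_add_three_add_one]
    have t2 : cTgt (w + cornerUnit j, j + 1) = s(w, w + cornerUnit j) := by
      rw [cTgt]; simp only; rw [fin4_add_one_add_one, cornerUnit_add_two, ← sub_eq_add_neg, add_sub_cancel_right,
        Sym2.eq_swap]
    refine ⟨?_, ?_, ?_, ?_⟩ <;> by_contra hne <;> have hn := nextCorner_eq_of_cnt_ne_zero c hc hne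
    · rw [nextCorner_of_mem (by rw [t1]; exact hw), Prod.mk.injEq] at hn
      exact absurd hn.2 (by dsimp only; generalize j = i; revert i; decide)
    · by_cases h' : cTgt (w, j) ∈ β
      · rw [nextCorner_of_mem h', Prod.mk.injEq] at hn
        exact cornerUnit_ne_zero (j + 1) (by simpa using hn.1)
      · rw [nextCorner_of_not_mem h', Prod.mk.injEq] at hn
        exact absurd hn.2 (by dsimp only; generalize j = i; revert i; decide)
    · rw [nextCorner_of_mem (by rw [t2]; exact hw), Prod.mk.injEq] at hn
      exact absurd hn.2 (by dsimp only; generalize j = i; revert i; decide)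
    · by_cases h' : cTgt (w + cornerUnit j, j + 2) ∈ β
      · rw [nextCorner_of_mem h', Prod.mk.injEq] at hn
        exact cornerUnit_ne_zero (j + 2 + 1) (by simpa using hn.1)
      · rw [nextCorner_of_not_mem h', Prod.mk.injEq] at hn
        exact absurd hn.2 (by dsimp only; generalize j = i; revert i; decide)
  -- reduce to `k ∈ {0, 1}` by reversing the edge
  suffices key : ∀ (w : Site 2) (j : Fin 4), (j = 0 ∨ j = 1) → s(w, w + cornerUnit j) ∈ β →
      c.W (2 * w 0 - 1, 2 * w 1 - 1) = c.W (2 * (w + cornerUnit j) 0 - 1, 2 * (w + cornerUnit j) 1 - 1) by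
    have hk : (k = 0 ∨ k = 1) ∨ (k = 0 + 2 ∨ k = 1 + 2) := by fin_cases k <;> simp
    rcases hk with hk | hk
    · exact key u k hk h
    · obtain ⟨j, hj, rfl⟩ : ∃ j : Fin 4, (j = 0 ∨ j = 1) ∧ k = j + 2 := by
        rcases hk with rfl | rfl
        · exact ⟨0, Or.inl rfl, rfl⟩
        · exact ⟨1, Or.inr rfl, rfl⟩
      have hw : s(u + cornerUnit (j + 2), u + cornerUnit (j + 2) + cornerUnit j) ∈ β := by
        rwa [cornerUnit_add_two, ← sub_eq_add_neg, sub_add_cancel, Sym2.eq_swap, sub_eq_add_neg, ← cornerUnit_add_two]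
      have := key (u + cornerUnit (j + 2)) j hj hw
      rw [cornerUnit_add_two, ← sub_eq_add_neg, sub_add_cancel] at this
      rw [cornerUnit_add_two, ← sub_eq_add_neg]
      exact this.symm
  intro w j hj hw
  obtain ⟨h1, h2, h3, h4⟩ := hA w j hw
  rcases hj with rfl | rfl
  · -- horizontal edge `{w, w + e₀}`: faces `(2w₀-1, 2w₁-1) | (2w₀, 2w₁-1) | (2w₀+1, 2w₁-1)`
    have e1 := c.W_succ_fst (2 * w 0 - 1) (2 * w 1 - 1)
    have e2 := c.W_succ_fst (2 * w 0) (2 * w 1 - 1)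
    rw [sub_add_cancel, c.cV_eq_cnt, sub_add_cancel] at e1
    rw [c.cV_eq_cnt, sub_add_cancel] at e2
    have c1 : code (w, (0 : Fin 4) + 3) = (2 * w 0, 2 * w 1 - 1) := by
      simp [code, codeOff, show (0 : Fin 4) + 3 = 3 from rfl]; ring
    have c2 : code (w, (0 : Fin 4)) = (2 * w 0, 2 * w 1) := by simp [code, codeOff]
    have c3 : code (w + cornerUnit 0, (0 : Fin 4) + 1) = (2 * w 0 + 1, 2 * w 1) := by
      simp [code, codeOff, cornerUnit, show (0 : Fin 4) + 1 = 1 from rfl]; ring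
    have c4 : code (w + cornerUnit 0, (0 : Fin 4) + 2) = (2 * w 0 + 1, 2 * w 1 - 1) := by
      simp [code, codeOff, cornerUnit, show (0 : Fin 4) + 2 = 2 from rfl]; constructor <;> ring
    rw [c1, c2] at h1 h2
    rw [c3, c4] at h3 h4
    rw [h1, h2] at e1
    rw [h4, h3] at e2
    have : (2 * (w + cornerUnit 0) 0 - 1, 2 * (w + cornerUnit 0) 1 - 1) = (2 * w 0 + 1, 2 * w 1 - 1) := by
      simp [cornerUnit]; ring
    rw [this, e2, e1]; ring
  · -- vertical edge `{w, w + e₁}`: faces `(2w₀-1, 2w₁-1) / (2w₀-1, 2w₁) / (2w₀-1, 2w₁+1)`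
    have e1 := c.W_succ_snd (2 * w 0 - 1) (2 * w 1 - 1)
    have e2 := c.W_succ_snd (2 * w 0 - 1) (2 * w 1)
    rw [sub_add_cancel, c.cH_eq_cnt, sub_add_cancel] at e1
    rw [c.cH_eq_cnt, sub_add_cancel] at e2
    have c1 : code (w, (1 : Fin 4) + 3) = (2 * w 0, 2 * w 1) := by
      simp [code, codeOff, show (1 : Fin 4) + 3 = 0 from rfl]
    have c2 : code (w, (1 : Fin 4)) = (2 * w 0 - 1, 2 * w 1) := by simp [code, codeOff]; ring
    have c3 : code (w + cornerUnit 1, (1 : Fin 4) + 1) = (2 * w 0 - 1, 2 * w 1 + 1) := by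
      simp [code, codeOff, cornerUnit, show (1 : Fin 4) + 1 = 2 from rfl]; constructor <;> ring
    have c4 : code (w + cornerUnit 1, (1 : Fin 4) + 2) = (2 * w 0, 2 * w 1 + 1) := by
      simp [code, codeOff, cornerUnit, show (1 : Fin 4) + 2 = 3 from rfl]; ring
    rw [c1, c2] at h1 h2
    rw [c3, c4] at h3 h4
    rw [h2, h1] at e1
    rw [h3, h4] at e2
    have : (2 * (w + cornerUnit 1) 0 - 1, 2 * (w + cornerUnit 1) 1 - 1) = (2 * w 0 - 1, 2 * w 1 + 1) := by
      simp [cornerUnit]; ring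
    rw [this, e2, e1]; ring

/-- **Corners off the cycle do not separate their vertex from their face**: if the corner
`(v, k)` is not on the cycle, the fine faces of `v` and of `faceAt v k` have the same winding
number (the coded point of the corner is unvisited). [folklore] -/
theorem coded_W_vFace_eq_fFace_of_notMem (c : ClosedWalk Q) (hc : ∀ m, c.v m = code (cornerOrbit β q m)) {v : Site 2} {k : Fin 4} (h : ∀ m, cornerOrbit β q m ≠ (v, k)) :
    c.W (2 * v 0 - 1, 2 * v 1 - 1) = c.W (2 * faceAt v k 0, 2 * faceAt v k 1) := by
  have hP : ∀ j, c.v j ≠ code (v, k) := fun j hj => h j (code_injective (by rw [← hc]; exact hj))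
  obtain ⟨hd1, hd2⟩ := W_diag_eq_of_notMem c hP
  have hk : k = 0 ∨ k = 1 ∨ k = 2 ∨ k = 3 := by fin_cases k <;> simp
  rcases hk with rfl | rfl | rfl | rfl
  · have e1 : code (v, (0 : Fin 4)) = (2 * v 0, 2 * v 1) := by simp [code, codeOff]
    rw [e1] at hd1
    rw [hd1]; simp [faceAt, cornerOff]
  · have e1 : code (v, (1 : Fin 4)) = (2 * v 0 - 1, 2 * v 1) := by simp [code, codeOff]; ring
    rw [e1] at hd2
    have : ((2 * faceAt v 1 0, 2 * faceAt v 1 1) : ℤ × ℤ) = (2 * v 0 - 1 - 1, 2 * v 1) := by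
      simp [faceAt, cornerOff]; ring
    rw [this, hd2]
  · have e1 : code (v, (2 : Fin 4)) = (2 * v 0 - 1, 2 * v 1 - 1) := by simp [code, codeOff]; constructor <;> ring
    rw [e1] at hd1
    have : ((2 * faceAt v 2 0, 2 * faceAt v 2 1) : ℤ × ℤ) = (2 * v 0 - 1 - 1, 2 * v 1 - 1 - 1) := by
      simp [faceAt, cornerOff]; constructor <;> ring
    rw [this, hd1]
  · have e1 : code (v, (3 : Fin 4)) = (2 * v 0, 2 * v 1 - 1) := by simp [code, codeOff]; ring
    rw [e1] at hd2
    have : ((2 * faceAt v 3 0, 2 * faceAt v 3 1) : ℤ × ℤ) = (2 * v 0, 2 * v 1 - 1 - 1) := by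
      simp [faceAt, cornerOff]; ring
    rw [this, ← hd2]

end CodedCycle

end Summit.CriticalPhenomena.CardyFormulaZ2.Cruxes.ParafermionPrecompact.KenyonStreamSecondRelation

end
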